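import Summits.QuantumFields.YangMills.Theorems.AllWindowsColdBoxBoxHighLineTiltSecondOrder

/-!
# T-S5.13n «TiltNormTransfer» — norm transfer, variance minimality, Cauchy–Schwarz and re-centring along the exponential tilt

Plumbing lemmas for the assembler of `stub_landauSecondOrder` (T-S5.13; planner ym-idea-2 g18's `ASSEMBLY-S5.md` §6 «NORM TRANSFER» and
«RE-CENTRING INSIDE PRODUCTS», used in (e4)/(e5)), in the letters of ✓`…Step2Tilt` (`Tilt.tiltExp μ U t G = ∫ G e^{tU} dμ / ∫ e^{tU} dμ`,
`Tilt.tiltCum4`) and over fcl-p3's ✓`…TiltSecondOrder` (bridge `tiltExp_eq_integral_tilted`, everywhere-bounded measurable observables on a finite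
measure `μ ≠ 0`):

* (n1) `Tilt.integral_mul_exp_le/ge`, **`Tilt.tiltExp_le_of_nonneg` / `Tilt.tiltExp_ge_of_nonneg`** — for `0 ≤ G` integrable, `|U| ≤ B` a.e., `0 ≤ t`:
  `e^{−2tB}·(∫G dμ)/μ(Ω) ≤ E_t[G] ≤ e^{2tB}·(∫G dμ)/μ(Ω)` (the `e^{tU} ∈ [e^{−B}, e^{B}]` sandwich);
* (n2) **`Tilt.tiltExp_centredSq_eq` / `…_le`** — `E_t[(G − E_tG)²] = E_t[(G − m)²] − (E_tG − m)² ≤ E_t[(G − m)²]` for every constant `m`;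
* (n3) **`Tilt.abs_tiltExp_mul_le`** — `|E_t[GW]| ≤ √E_t[G²]·√E_t[W²]` (Mathlib's Hölder at `(2,2)` on `μ.tilted`); `Tilt.tiltExp_sq_le` (`(E_tG)² ≤ E_t[G²]`);
* (n4) **`Tilt.tiltExp_centredSq_mul_centredSq_le`** — `E_t[(G−E_tG)²(W−E_tW)²] ≤ 4·E_t[(G−a)²(W−b)²] + 12·E_t[(G−a)²]·E_t[(W−b)²]` for all `a, b`;
  **`Tilt.abs_tiltCum4_le`** — `|κ₄,t(G₁,G₂,U,U)| ≤ √E_t[G̃₁²Ũ²]·√E_t[G̃₂²Ũ²] + 3·√E_t[G̃₁²]·√E_t[G̃₂²]·E_t[Ũ²]`, `X̃ = X − E_tX`.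

(n5, the `gaussAvg`/`smallField` instance, is the companion file `…TiltNormTransferGauss`.)  Tree + Mathlib; no definitions.
HONEST LABEL: abstract measure-theoretic plumbing for T-S5.13 of the XL stub S5 (LINE-19 ⟨stmt-QuantumFields-24004⟩/⟨24335⟩) on a critic-PASSed DRAFT line;
13, S5, U5, ⟨24004⟩ ⟨24335⟩ ⟨24336⟩ remain OPEN; **the Yang–Mills mass gap is NOT proved by this file; no summit is proved by a line.**
Seat ym-line-sfw-p2-w5 g22 (EXTRA WIDTH seat w5, cell ym-idea-1).
-/

set_option autoImplicit false

noncomputable section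

open MeasureTheory Set
open Summit.QuantumFields.YangMills.Cruxes.NT.SkewResponse

namespace Summit.QuantumFields.YangMills.Theorems.AllWindowsColdBoxBoxHighLine

namespace Tilt

variable {Ω : Type*} [MeasurableSpace Ω] {μ : Measure Ω}

/-! ## (n1) NORM TRANSFER: the `e^{tU} ∈ [e^{−tB}, e^{tB}]` sandwich -/

omit [MeasurableSpace Ω] in
/-- `e^{−tB} ≤ e^{tU(x)} ≤ e^{tB}` when `|U x| ≤ B`, `0 ≤ t`. -/
theorem exp_mul_mem_Icc {U : Ω → ℝ} {B t : ℝ} (ht : 0 ≤ t) {x : Ω} (hx : |U x| ≤ B) :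
    Real.exp (-(t * B)) ≤ Real.exp (t * U x) ∧ Real.exp (t * U x) ≤ Real.exp (t * B) := by
  have h := abs_le.mp hx
  constructor <;> apply Real.exp_le_exp.mpr <;> nlinarith

/-- **Upper sandwich**: `∫ G e^{tU} dμ ≤ e^{tB} ∫ G dμ` for `0 ≤ G` integrable, `|U| ≤ B` a.e., `0 ≤ t`. -/
theorem integral_mul_exp_le {U G : Ω → ℝ} {B t : ℝ} (ht : 0 ≤ t) (hUb : ∀ᵐ x ∂μ, |U x| ≤ B) (hG0 : 0 ≤ G) (hG : Integrable G μ) :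
    ∫ x, G x * Real.exp (t * U x) ∂μ ≤ Real.exp (t * B) * ∫ x, G x ∂μ := by
  rw [← integral_const_mul]
  refine integral_mono_of_nonneg (ae_of_all _ fun x => mul_nonneg (hG0 x) (Real.exp_pos _).le) (hG.const_mul _) ?_
  filter_upwards [hUb] with x hx
  rw [mul_comm (Real.exp (t * B))]
  exact mul_le_mul_of_nonneg_left (exp_mul_mem_Icc ht hx).2 (hG0 x)

/-- **Lower sandwich**: `e^{−tB} ∫ G dμ ≤ ∫ G e^{tU} dμ` for `0 ≤ G` integrable with `G e^{tU}` integrable, `|U| ≤ B` a.e., `0 ≤ t`. -/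
theorem integral_mul_exp_ge {U G : Ω → ℝ} {B t : ℝ} (ht : 0 ≤ t) (hUb : ∀ᵐ x ∂μ, |U x| ≤ B) (hG0 : 0 ≤ G)
    (hGe : Integrable (fun x => G x * Real.exp (t * U x)) μ) :
    Real.exp (-(t * B)) * ∫ x, G x ∂μ ≤ ∫ x, G x * Real.exp (t * U x) ∂μ := by
  rw [← integral_const_mul]
  refine integral_mono_of_nonneg (ae_of_all _ fun x => mul_nonneg (Real.exp_pos _).le (hG0 x)) hGe ?_
  filter_upwards [hUb] with x hx
  rw [mul_comm (Real.exp (-(t * B)))]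
  exact mul_le_mul_of_nonneg_left (exp_mul_mem_Icc ht hx).1 (hG0 x)

/-- The partition function is at least `e^{−tB}·μ(Ω)`. -/
theorem integral_exp_ge [IsFiniteMeasure μ] {U : Ω → ℝ} {B t : ℝ} (ht : 0 ≤ t) (hU : AEMeasurable U μ)
    (hUb : ∀ᵐ x ∂μ, |U x| ≤ B) :
    Real.exp (-(t * B)) * μ.real univ ≤ ∫ x, Real.exp (t * U x) ∂μ := by
  have hint : Integrable (fun x => Real.exp (t * U x)) μ := by
    refine Integrable.of_bound (by fun_prop) (Real.exp (t * B)) ?_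
    filter_upwards [hUb] with x hx
    rw [Real.norm_eq_abs, abs_of_pos (Real.exp_pos _)]
    exact (exp_mul_mem_Icc ht hx).2
  have h := integral_mul_exp_ge (μ := μ) (G := fun _ => (1 : ℝ)) ht hUb (fun _ => zero_le_one) (by simpa using hint)
  simpa [integral_const, smul_eq_mul] using h

/-- The partition function is at most `e^{tB}·μ(Ω)`. -/
theorem integral_exp_le [IsFiniteMeasure μ] {U : Ω → ℝ} {B t : ℝ} (ht : 0 ≤ t) (hUb : ∀ᵐ x ∂μ, |U x| ≤ B) :
    ∫ x, Real.exp (t * U x) ∂μ ≤ Real.exp (t * B) * μ.real univ := by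
  have h := integral_mul_exp_le (μ := μ) (G := fun _ => (1 : ℝ)) ht hUb (fun _ => zero_le_one) (integrable_const _)
  simpa [integral_const, smul_eq_mul] using h

/-- ★ **NORM TRANSFER, upper**: `E_t[G] ≤ e^{2tB} · (∫ G dμ)/μ(Ω)` for `0 ≤ G` integrable, `|U| ≤ B` a.e., `0 ≤ t`, `μ ≠ 0` finite. -/
theorem tiltExp_le_of_nonneg [IsFiniteMeasure μ] [NeZero μ] {U G : Ω → ℝ} {B t : ℝ} (ht : 0 ≤ t) (hU : AEMeasurable U μ)
    (hUb : ∀ᵐ x ∂μ, |U x| ≤ B) (hG0 : 0 ≤ G) (hG : Integrable G μ) :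
    tiltExp μ U t G ≤ Real.exp (2 * t * B) * ((∫ x, G x ∂μ) / μ.real univ) := by
  have hμ : 0 < μ.real univ := ENNReal.toReal_pos (NeZero.ne _) (measure_ne_top μ _)
  have hZ : 0 < ∫ x, Real.exp (t * U x) ∂μ :=
    lt_of_lt_of_le (mul_pos (Real.exp_pos _) hμ) (integral_exp_ge ht hU hUb)
  have hG' : 0 ≤ ∫ x, G x ∂μ := integral_nonneg hG0
  unfold tiltExp
  rw [div_le_iff₀ hZ]
  calc ∫ x, G x * Real.exp (t * U x) ∂μ ≤ Real.exp (t * B) * ∫ x, G x ∂μ := integral_mul_exp_le ht hUb hG0 hG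
    _ = Real.exp (2 * t * B) * ((∫ x, G x ∂μ) / μ.real univ) * (Real.exp (-(t * B)) * μ.real univ) := by
        rw [show (2 * t * B) = t * B + t * B by ring, Real.exp_add, Real.exp_neg]
        field_simp
    _ ≤ Real.exp (2 * t * B) * ((∫ x, G x ∂μ) / μ.real univ) * ∫ x, Real.exp (t * U x) ∂μ :=
        mul_le_mul_of_nonneg_left (integral_exp_ge ht hU hUb) (by positivity)

/-- ★ **NORM TRANSFER, lower**: `e^{−2tB} · (∫ G dμ)/μ(Ω) ≤ E_t[G]` for `0 ≤ G` with `G e^{tU}` integrable, `|U| ≤ B` a.e., `0 ≤ t`. -/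
theorem tiltExp_ge_of_nonneg [IsFiniteMeasure μ] [NeZero μ] {U G : Ω → ℝ} {B t : ℝ} (ht : 0 ≤ t) (hU : AEMeasurable U μ)
    (hUb : ∀ᵐ x ∂μ, |U x| ≤ B) (hG0 : 0 ≤ G) (hGe : Integrable (fun x => G x * Real.exp (t * U x)) μ) :
    Real.exp (-(2 * t * B)) * ((∫ x, G x ∂μ) / μ.real univ) ≤ tiltExp μ U t G := by
  have hμ : 0 < μ.real univ := ENNReal.toReal_pos (NeZero.ne _) (measure_ne_top μ _)
  have hZ : 0 < ∫ x, Real.exp (t * U x) ∂μ :=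
    lt_of_lt_of_le (mul_pos (Real.exp_pos _) hμ) (integral_exp_ge ht hU hUb)
  have hG' : 0 ≤ ∫ x, G x ∂μ := integral_nonneg hG0
  unfold tiltExp
  rw [le_div_iff₀ hZ]
  calc Real.exp (-(2 * t * B)) * ((∫ x, G x ∂μ) / μ.real univ) * ∫ x, Real.exp (t * U x) ∂μ
      ≤ Real.exp (-(2 * t * B)) * ((∫ x, G x ∂μ) / μ.real univ) * (Real.exp (t * B) * μ.real univ) :=
        mul_le_mul_of_nonneg_left (integral_exp_le ht hUb) (by positivity)
    _ = Real.exp (-(t * B)) * ∫ x, G x ∂μ := by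
        rw [show (-(2 * t * B)) = -(t * B) + -(t * B) by ring, Real.exp_add, Real.exp_neg (t * B)]
        field_simp
    _ ≤ ∫ x, G x * Real.exp (t * U x) ∂μ := integral_mul_exp_ge ht hUb hG0 hGe

/-! ## (n2) VARIANCE MINIMALITY at the tilted mean -/

/-- **`E_t[(G − E_tG)²] = E_t[(G − m)²] − (E_tG − m)²`** for every constant `m` (bounded measurable `U`, `G`; `μ ≠ 0` finite). -/
theorem tiltExp_centredSq_eq [IsFiniteMeasure μ] [NeZero μ] {U G : Ω → ℝ} {BU BG : ℝ} (hU : Measurable U) (hG : Measurable G)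
    (hUb : ∀ x, |U x| ≤ BU) (hGb : ∀ x, |G x| ≤ BG) (t m : ℝ) :
    tiltExp μ U t (fun x => (G x - tiltExp μ U t G) ^ 2) = tiltExp μ U t (fun x => (G x - m) ^ 2) - (tiltExp μ U t G - m) ^ 2 := by
  have h1 := tiltExp_sub_mul_sub (μ := μ) hU hG hG hUb hGb hGb (tiltExp μ U t G) (tiltExp μ U t G) t
  have h2 := tiltExp_sub_mul_sub (μ := μ) hU hG hG hUb hGb hGb m m t
  simp only [← pow_two] at h1 h2
  rw [h1, h2]
  ring

/-- ★ **`E_t[(G − E_tG)²] ≤ E_t[(G − m)²]`** for every constant `m`: centre at any convenient constant (e.g. the Gaussian mean). -/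
theorem tiltExp_centredSq_le [IsFiniteMeasure μ] [NeZero μ] {U G : Ω → ℝ} {BU BG : ℝ} (hU : Measurable U) (hG : Measurable G)
    (hUb : ∀ x, |U x| ≤ BU) (hGb : ∀ x, |G x| ≤ BG) (t m : ℝ) :
    tiltExp μ U t (fun x => (G x - tiltExp μ U t G) ^ 2) ≤ tiltExp μ U t (fun x => (G x - m) ^ 2) := by
  rw [tiltExp_centredSq_eq hU hG hUb hGb t m]
  linarith [sq_nonneg (tiltExp μ U t G - m)]

/-! ## (n3) CAUCHY–SCHWARZ in `L²(μ_t)` -/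

/-- ★ **`|E_t[GW]| ≤ √E_t[G²] · √E_t[W²]`** (bounded measurable `U`, `G`, `W`; `μ ≠ 0` finite). -/
theorem abs_tiltExp_mul_le {G W : Ω → ℝ} {BG BW : ℝ} (hG : Measurable G) (hW : Measurable W)
    (hGb : ∀ x, |G x| ≤ BG) (hWb : ∀ x, |W x| ≤ BW) (U : Ω → ℝ) (t : ℝ) :
    |tiltExp μ U t (fun x => G x * W x)| ≤
      Real.sqrt (tiltExp μ U t (fun x => G x ^ 2)) * Real.sqrt (tiltExp μ U t (fun x => W x ^ 2)) := by
  simp only [tiltExp_eq_integral_tilted]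
  set ν := μ.tilted fun x => t * U x
  have hGm : MemLp (fun x => |G x|) (ENNReal.ofReal 2) ν :=
    MemLp.of_bound hG.abs.aestronglyMeasurable BG (ae_of_all _ fun x => by rw [Real.norm_eq_abs, abs_abs]; exact hGb x)
  have hWm : MemLp (fun x => |W x|) (ENNReal.ofReal 2) ν :=
    MemLp.of_bound hW.abs.aestronglyMeasurable BW (ae_of_all _ fun x => by rw [Real.norm_eq_abs, abs_abs]; exact hWb x)
  have h := integral_mul_le_Lp_mul_Lq_of_nonneg Real.HolderConjugate.two_two
    (ae_of_all _ fun x => abs_nonneg (G x)) (ae_of_all _ fun x => abs_nonneg (W x)) hGm hWm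
  have r1 : ∀ x, |G x| ^ (2 : ℝ) = G x ^ 2 := fun x => by rw [Real.rpow_two, sq_abs]
  have r2 : ∀ x, |W x| ^ (2 : ℝ) = W x ^ 2 := fun x => by rw [Real.rpow_two, sq_abs]
  simp only [r1, r2] at h
  rw [Real.sqrt_eq_rpow, Real.sqrt_eq_rpow]
  calc |∫ x, G x * W x ∂ν| ≤ ∫ x, |G x * W x| ∂ν := abs_integral_le_integral_abs
    _ = ∫ x, |G x| * |W x| ∂ν := integral_congr_ae (ae_of_all _ fun x => abs_mul _ _)
    _ ≤ (∫ x, G x ^ 2 ∂ν) ^ (1 / (2 : ℝ)) * (∫ x, W x ^ 2 ∂ν) ^ (1 / (2 : ℝ)) := h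

/-- **Jensen for the square**: `(E_tG)² ≤ E_t[G²]`. -/
theorem tiltExp_sq_le [IsFiniteMeasure μ] [NeZero μ] {U G : Ω → ℝ} {BU BG : ℝ} (hU : Measurable U) (hG : Measurable G)
    (hUb : ∀ x, |U x| ≤ BU) (hGb : ∀ x, |G x| ≤ BG) (t : ℝ) :
    tiltExp μ U t G ^ 2 ≤ tiltExp μ U t (fun x => G x ^ 2) := by
  have h := abs_tiltExp_mul_le (μ := μ) hG measurable_const hGb (fun _ => (abs_one : |(1 : ℝ)| = 1).le) U t
  have h1 : tiltExp μ U t (fun _ => (1 : ℝ) ^ 2) = 1 := by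
    haveI := isProbabilityMeasure_tilted_mul (μ := μ) hU hUb t
    rw [tiltExp_eq_integral_tilted]; simp
  simp only [mul_one] at h
  rw [h1, Real.sqrt_one, mul_one] at h
  have h0 : 0 ≤ tiltExp μ U t (fun x => G x ^ 2) := by
    haveI := isProbabilityMeasure_tilted_mul (μ := μ) hU hUb t
    rw [tiltExp_eq_integral_tilted]; exact integral_nonneg fun x => sq_nonneg _
  have h' : |tiltExp μ U t G| ≤ Real.sqrt (tiltExp μ U t (fun x => G x ^ 2)) := by simpa using h
  have := pow_le_pow_left₀ (abs_nonneg _) h' 2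
  rw [sq_abs, Real.sq_sqrt h0] at this
  exact this

/-! ## (n4) RE-CENTRING INSIDE PRODUCTS and the bound on the fourth cumulant -/

/-- Monotonicity of `E_t` (pointwise inequality of bounded measurable observables). -/
theorem tiltExp_mono {F G : Ω → ℝ} {BF BG : ℝ} (hF : Measurable F) (hG : Measurable G)
    (hFb : ∀ x, |F x| ≤ BF) (hGb : ∀ x, |G x| ≤ BG) (U : Ω → ℝ) (t : ℝ) (hFG : ∀ x, F x ≤ G x) :
    tiltExp μ U t F ≤ tiltExp μ U t G := by
  simp only [tiltExp_eq_integral_tilted]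
  exact integral_mono (integrable_of_abs_le hF hFb) (integrable_of_abs_le hG hGb) hFG

/-- `E_t` of a constant. -/
theorem tiltExp_const [IsFiniteMeasure μ] [NeZero μ] {U : Ω → ℝ} {BU : ℝ} (hU : Measurable U) (hUb : ∀ x, |U x| ≤ BU) (t c : ℝ) :
    tiltExp μ U t (fun _ => c) = c := by
  haveI := isProbabilityMeasure_tilted_mul (μ := μ) hU hUb t
  rw [tiltExp_eq_integral_tilted]; simp

/-- Linearity pieces of `E_t`: sums. -/
theorem tiltExp_add {F G : Ω → ℝ} {BF BG : ℝ} (hF : Measurable F) (hG : Measurable G)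
    (hFb : ∀ x, |F x| ≤ BF) (hGb : ∀ x, |G x| ≤ BG) (U : Ω → ℝ) (t : ℝ) :
    tiltExp μ U t (fun x => F x + G x) = tiltExp μ U t F + tiltExp μ U t G := by
  simp only [tiltExp_eq_integral_tilted]
  exact integral_add (integrable_of_abs_le hF hFb) (integrable_of_abs_le hG hGb)

/-- Linearity pieces of `E_t`: scalar multiples. -/
theorem tiltExp_const_mul (U : Ω → ℝ) (t c : ℝ) (F : Ω → ℝ) :
    tiltExp μ U t (fun x => c * F x) = c * tiltExp μ U t F := by
  unfold tiltExp
  rw [← mul_div_assoc, ← integral_const_mul]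
  congr 1
  refine integral_congr_ae (ae_of_all _ fun x => ?_)
  beta_reduce
  ring

/-- ★ **RE-CENTRING INSIDE PRODUCTS**: for all constants `a, b`,
`E_t[(G − E_tG)²(W − E_tW)²] ≤ 4·E_t[(G − a)²(W − b)²] + 12·E_t[(G − a)²]·E_t[(W − b)²]`
(pointwise `(x − δ)² ≤ 2x² + 2δ²` with `δ = E_t[G − a]`, `ε = E_t[W − b]`, then Jensen `δ² ≤ E_t[(G − a)²]`, `ε² ≤ E_t[(W − b)²]`). -/
theorem tiltExp_centredSq_mul_centredSq_le [IsFiniteMeasure μ] [NeZero μ] {U G W : Ω → ℝ} {BU BG BW : ℝ} (hU : Measurable U)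
    (hG : Measurable G) (hW : Measurable W) (hUb : ∀ x, |U x| ≤ BU) (hGb : ∀ x, |G x| ≤ BG) (hWb : ∀ x, |W x| ≤ BW) (t a b : ℝ) :
    tiltExp μ U t (fun x => (G x - tiltExp μ U t G) ^ 2 * (W x - tiltExp μ U t W) ^ 2) ≤
      4 * tiltExp μ U t (fun x => (G x - a) ^ 2 * (W x - b) ^ 2) +
        12 * (tiltExp μ U t (fun x => (G x - a) ^ 2) * tiltExp μ U t (fun x => (W x - b) ^ 2)) := by
  haveI := isProbabilityMeasure_tilted_mul (μ := μ) hU hUb t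
  have hmGa : tiltExp μ U t (fun x => G x - a) = tiltExp μ U t G - a := tiltExp_sub_const hU hG hUb hGb a t
  have hmWb : tiltExp μ U t (fun x => W x - b) = tiltExp μ U t W - b := tiltExp_sub_const hU hW hUb hWb b t
  set mG := tiltExp μ U t G with hmG
  set mW := tiltExp μ U t W with hmW
  set δ := mG - a with hδ
  set ε := mW - b with hε
  -- shifted observables are bounded measurable
  have hGa : Measurable fun x => G x - a := hG.sub measurable_const
  have hWb' : Measurable fun x => W x - b := hW.sub measurable_const
  have hGab : ∀ x, |G x - a| ≤ BG + |a| := fun x => (abs_sub _ _).trans (add_le_add (hGb x) le_rfl)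
  have hWbb : ∀ x, |W x - b| ≤ BW + |b| := fun x => (abs_sub _ _).trans (add_le_add (hWb x) le_rfl)
  -- Jensen: δ² ≤ E_t[(G−a)²], ε² ≤ E_t[(W−b)²]
  have hδ2 : δ ^ 2 ≤ tiltExp μ U t (fun x => (G x - a) ^ 2) := by
    have h := tiltExp_sq_le (μ := μ) hU hGa hUb hGab t
    rwa [hmGa] at h
  have hε2 : ε ^ 2 ≤ tiltExp μ U t (fun x => (W x - b) ^ 2) := by
    have h := tiltExp_sq_le (μ := μ) hU hWb' hUb hWbb t
    rwa [hmWb] at h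
  have hg2 : 0 ≤ tiltExp μ U t (fun x => (G x - a) ^ 2) := le_trans (sq_nonneg _) hδ2
  have hw2 : 0 ≤ tiltExp μ U t (fun x => (W x - b) ^ 2) := le_trans (sq_nonneg _) hε2
  -- pointwise bound
  have hpt : ∀ x, (G x - mG) ^ 2 * (W x - mW) ^ 2 ≤
      4 * ((G x - a) ^ 2 * (W x - b) ^ 2) + 4 * ε ^ 2 * (G x - a) ^ 2 + 4 * δ ^ 2 * (W x - b) ^ 2 + 4 * δ ^ 2 * ε ^ 2 := by
    intro x
    have e1 : G x - mG = (G x - a) - δ := by rw [hδ]; ring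
    have e2 : W x - mW = (W x - b) - ε := by rw [hε]; ring
    rw [e1, e2]
    have h1 : ((G x - a) - δ) ^ 2 ≤ 2 * (G x - a) ^ 2 + 2 * δ ^ 2 := by nlinarith [sq_nonneg ((G x - a) + δ)]
    have h2 : ((W x - b) - ε) ^ 2 ≤ 2 * (W x - b) ^ 2 + 2 * ε ^ 2 := by nlinarith [sq_nonneg ((W x - b) + ε)]
    calc ((G x - a) - δ) ^ 2 * ((W x - b) - ε) ^ 2 ≤ (2 * (G x - a) ^ 2 + 2 * δ ^ 2) * (2 * (W x - b) ^ 2 + 2 * ε ^ 2) :=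
          mul_le_mul h1 h2 (sq_nonneg _) (by positivity)
      _ = _ := by ring
  -- integrate the pointwise bound
  simp only [tiltExp_eq_integral_tilted] at hδ2 hε2 hg2 hw2 ⊢
  set ν := μ.tilted fun x => t * U x
  have iG2 : Integrable (fun x => (G x - a) ^ 2) ν := by
    refine integrable_of_abs_le (hGa.pow_const 2) (B := (BG + |a|) ^ 2) fun x => ?_
    rw [abs_pow]; exact pow_le_pow_left₀ (abs_nonneg _) (hGab x) 2
  have iW2 : Integrable (fun x => (W x - b) ^ 2) ν := by
    refine integrable_of_abs_le (hWb'.pow_const 2) (B := (BW + |b|) ^ 2) fun x => ?_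
    rw [abs_pow]; exact pow_le_pow_left₀ (abs_nonneg _) (hWbb x) 2
  have iGW : Integrable (fun x => (G x - a) ^ 2 * (W x - b) ^ 2) ν := by
    refine integrable_of_abs_le ((hGa.pow_const 2).mul (hWb'.pow_const 2)) (B := (BG + |a|) ^ 2 * (BW + |b|) ^ 2) fun x => ?_
    rw [abs_mul, abs_pow, abs_pow]
    exact mul_le_mul (pow_le_pow_left₀ (abs_nonneg _) (hGab x) 2) (pow_le_pow_left₀ (abs_nonneg _) (hWbb x) 2)
      (by positivity) (by positivity)
  have iL : Integrable (fun x => (G x - mG) ^ 2 * (W x - mW) ^ 2) ν := by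
    have hm1 : Measurable fun x => G x - mG := hG.sub measurable_const
    have hm2 : Measurable fun x => W x - mW := hW.sub measurable_const
    refine integrable_of_abs_le ((hm1.pow_const 2).mul (hm2.pow_const 2))
      (B := (BG + |mG|) ^ 2 * (BW + |mW|) ^ 2) fun x => ?_
    rw [abs_mul, abs_pow, abs_pow]
    exact mul_le_mul (pow_le_pow_left₀ (abs_nonneg _) ((abs_sub _ _).trans (add_le_add (hGb x) le_rfl)) 2)
      (pow_le_pow_left₀ (abs_nonneg _) ((abs_sub _ _).trans (add_le_add (hWb x) le_rfl)) 2) (by positivity) (by positivity)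
  have i1 : Integrable (fun x => 4 * ((G x - a) ^ 2 * (W x - b) ^ 2)) ν := iGW.const_mul 4
  have i2 : Integrable (fun x => 4 * ε ^ 2 * (G x - a) ^ 2) ν := iG2.const_mul _
  have i3 : Integrable (fun x => 4 * δ ^ 2 * (W x - b) ^ 2) ν := iW2.const_mul _
  have i12 : Integrable (fun x => 4 * ((G x - a) ^ 2 * (W x - b) ^ 2) + 4 * ε ^ 2 * (G x - a) ^ 2) ν := i1.add i2
  have i123 : Integrable (fun x => 4 * ((G x - a) ^ 2 * (W x - b) ^ 2) + 4 * ε ^ 2 * (G x - a) ^ 2 +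
      4 * δ ^ 2 * (W x - b) ^ 2) ν := i12.add i3
  have iR : Integrable (fun x => 4 * ((G x - a) ^ 2 * (W x - b) ^ 2) + 4 * ε ^ 2 * (G x - a) ^ 2 +
      4 * δ ^ 2 * (W x - b) ^ 2 + 4 * δ ^ 2 * ε ^ 2) ν := i123.add (integrable_const _)
  calc ∫ x, (G x - mG) ^ 2 * (W x - mW) ^ 2 ∂ν
      ≤ ∫ x, (4 * ((G x - a) ^ 2 * (W x - b) ^ 2) + 4 * ε ^ 2 * (G x - a) ^ 2 + 4 * δ ^ 2 * (W x - b) ^ 2 + 4 * δ ^ 2 * ε ^ 2) ∂ν :=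
        integral_mono iL iR hpt
    _ = 4 * ∫ x, (G x - a) ^ 2 * (W x - b) ^ 2 ∂ν + 4 * ε ^ 2 * ∫ x, (G x - a) ^ 2 ∂ν + 4 * δ ^ 2 * ∫ x, (W x - b) ^ 2 ∂ν +
          4 * δ ^ 2 * ε ^ 2 := by
        rw [integral_add i123 (integrable_const _), integral_add i12 i3, integral_add i1 i2, integral_const_mul,
          integral_const_mul, integral_const_mul, integral_const]
        simp
    _ ≤ 4 * ∫ x, (G x - a) ^ 2 * (W x - b) ^ 2 ∂ν + 12 * ((∫ x, (G x - a) ^ 2 ∂ν) * ∫ x, (W x - b) ^ 2 ∂ν) := by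
        nlinarith [mul_le_mul hδ2 hε2 (sq_nonneg _) hg2, mul_le_mul_of_nonneg_right hε2 hg2, mul_le_mul_of_nonneg_right hδ2 hw2]

/-- ★ **BOUND ON THE FOURTH JOINT CUMULANT ALONG THE TILT**: with `X̃ = X − E_tX`,
`|κ₄,t(G₁,G₂,U,U)| ≤ √E_t[G̃₁²Ũ²]·√E_t[G̃₂²Ũ²] + 3·√E_t[G̃₁²]·√E_t[G̃₂²]·E_t[Ũ²]` (three Cauchy–Schwarz steps). -/
theorem abs_tiltCum4_le [IsFiniteMeasure μ] [NeZero μ] {U G₁ G₂ : Ω → ℝ} {BU B₁ B₂ : ℝ} (hU : Measurable U)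
    (h₁ : Measurable G₁) (h₂ : Measurable G₂) (hUb : ∀ x, |U x| ≤ BU) (h₁b : ∀ x, |G₁ x| ≤ B₁) (h₂b : ∀ x, |G₂ x| ≤ B₂) (t : ℝ) :
    |tiltCum4 μ U t G₁ G₂| ≤
      Real.sqrt (tiltExp μ U t (fun x => (G₁ x - tiltExp μ U t G₁) ^ 2 * (U x - tiltExp μ U t U) ^ 2)) *
          Real.sqrt (tiltExp μ U t (fun x => (G₂ x - tiltExp μ U t G₂) ^ 2 * (U x - tiltExp μ U t U) ^ 2)) +
        3 * (Real.sqrt (tiltExp μ U t (fun x => (G₁ x - tiltExp μ U t G₁) ^ 2)) *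
          Real.sqrt (tiltExp μ U t (fun x => (G₂ x - tiltExp μ U t G₂) ^ 2))) *
          tiltExp μ U t (fun x => (U x - tiltExp μ U t U) ^ 2) := by
  set m₁ := tiltExp μ U t G₁
  set m₂ := tiltExp μ U t G₂
  set mU := tiltExp μ U t U
  -- the centred observables are bounded measurable
  have hc₁ : Measurable fun x => G₁ x - m₁ := h₁.sub measurable_const
  have hc₂ : Measurable fun x => G₂ x - m₂ := h₂.sub measurable_const
  have hcU : Measurable fun x => U x - mU := hU.sub measurable_const
  have hc₁b : ∀ x, |G₁ x - m₁| ≤ B₁ + |m₁| := fun x => (abs_sub _ _).trans (add_le_add (h₁b x) le_rfl)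
  have hc₂b : ∀ x, |G₂ x - m₂| ≤ B₂ + |m₂| := fun x => (abs_sub _ _).trans (add_le_add (h₂b x) le_rfl)
  have hcUb : ∀ x, |U x - mU| ≤ BU + |mU| := fun x => (abs_sub _ _).trans (add_le_add (hUb x) le_rfl)
  have hp₁ : Measurable fun x => (G₁ x - m₁) * (U x - mU) := hc₁.mul hcU
  have hp₂ : Measurable fun x => (G₂ x - m₂) * (U x - mU) := hc₂.mul hcU
  have hp₁b : ∀ x, |(G₁ x - m₁) * (U x - mU)| ≤ (B₁ + |m₁|) * (BU + |mU|) := fun x => by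
    rw [abs_mul]; exact mul_le_mul (hc₁b x) (hcUb x) (abs_nonneg _) ((abs_nonneg _).trans (hc₁b x))
  have hp₂b : ∀ x, |(G₂ x - m₂) * (U x - mU)| ≤ (B₂ + |m₂|) * (BU + |mU|) := fun x => by
    rw [abs_mul]; exact mul_le_mul (hc₂b x) (hcUb x) (abs_nonneg _) ((abs_nonneg _).trans (hc₂b x))
  -- the three Cauchy–Schwarz estimates
  have hA := abs_tiltExp_mul_le (μ := μ) hp₁ hp₂ hp₁b hp₂b U t
  have hB := abs_tiltExp_mul_le (μ := μ) hc₁ hc₂ hc₁b hc₂b U t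
  have hC₁ := abs_tiltExp_mul_le (μ := μ) hc₁ hcU hc₁b hcUb U t
  have hC₂ := abs_tiltExp_mul_le (μ := μ) hc₂ hcU hc₂b hcUb U t
  have eA : (fun x => (G₁ x - m₁) * (U x - mU) * ((G₂ x - m₂) * (U x - mU))) =
      fun x => (G₁ x - m₁) * (G₂ x - m₂) * (U x - mU) ^ 2 := by funext x; ring
  have eP₁ : (fun x => ((G₁ x - m₁) * (U x - mU)) ^ 2) = fun x => (G₁ x - m₁) ^ 2 * (U x - mU) ^ 2 := by funext x; ring
  have eP₂ : (fun x => ((G₂ x - m₂) * (U x - mU)) ^ 2) = fun x => (G₂ x - m₂) ^ 2 * (U x - mU) ^ 2 := by funext x; ring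
  rw [eA, eP₁, eP₂] at hA
  have hU2 : 0 ≤ tiltExp μ U t (fun x => (U x - mU) ^ 2) := by
    haveI := isProbabilityMeasure_tilted_mul (μ := μ) hU hUb t
    rw [tiltExp_eq_integral_tilted]; exact integral_nonneg fun x => sq_nonneg _
  have hs₁ := Real.sqrt_nonneg (tiltExp μ U t (fun x => (G₁ x - m₁) ^ 2))
  have hs₂ := Real.sqrt_nonneg (tiltExp μ U t (fun x => (G₂ x - m₂) ^ 2))
  have hsU := Real.sqrt_nonneg (tiltExp μ U t (fun x => (U x - mU) ^ 2))
  have hsq : Real.sqrt (tiltExp μ U t (fun x => (U x - mU) ^ 2)) * Real.sqrt (tiltExp μ U t (fun x => (U x - mU) ^ 2)) =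
      tiltExp μ U t (fun x => (U x - mU) ^ 2) := Real.mul_self_sqrt hU2
  unfold tiltCum4
  have h2 := abs_le.mp hB
  have h3 := abs_le.mp hC₁
  have h4 := abs_le.mp hC₂
  have h1 := abs_le.mp hA
  rw [abs_le]
  constructor <;> nlinarith [mul_le_mul (abs_le.mpr ⟨h3.1, h3.2⟩) (abs_le.mpr ⟨h4.1, h4.2⟩) (abs_nonneg _) (by positivity),
    abs_mul_self (tiltExp μ U t (fun x => (G₁ x - m₁) * (U x - mU))), mul_nonneg hs₁ hs₂, hU2,
    abs_nonneg (tiltExp μ U t (fun x => (G₁ x - m₁) * (U x - mU)) * tiltExp μ U t (fun x => (G₂ x - m₂) * (U x - mU))),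
    abs_mul (tiltExp μ U t (fun x => (G₁ x - m₁) * (U x - mU))) (tiltExp μ U t (fun x => (G₂ x - m₂) * (U x - mU)))]

end Tilt

end Summit.QuantumFields.YangMills.Theorems.AllWindowsColdBoxBoxHighLine

end
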